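import Summits.QuantumFields.YangMills.Theorems.LangevinControlUVFemtoCurvatureTwoPointAxisCovNonneg

/-!
# Crux `FemtoCurvatureTwoPointC` (stmt-QuantumFields-16204, route `LangevinControlUV`):
# block smearing only lowers the transverse plaquette covariance

Registered sub-goal `smearingDomination` of the line `birth` (lead c9, wave 2), verbatim the stub
`stub_smearingDomination` of the sibling line `conditional-covariance-floor` (serves both lines):
on `(ℤ/L)⁴` with Wilson's measure (compact `G`, continuous `ρ`, `β ≥ 0`), for
`P_x = N − Re tr ρ(U_{p(x;0,1)})` and the cube averages `B_m(s) = m⁻³ ∑_{v ∈ [0,m)³} P_{(v₀,v₁,s,v₂)}`,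
`Cov(B_m(0), B_m(t)) ≤ Cov(P_0, P_{t e₂}) =: K_t`.
**Proof.** `Cov(B_m(0), B_m(t)) = m⁻⁶ ∑_{v,w} M_{vw}`, `M_{vw} = Cov(P_{(v,0)}, P_{(w,t)})`
(bilinearity of Mathlib's `ProbabilityTheory.covariance`), and `M_{vw} + M_{wv} ≤ 2 K_t` for EVERY
pair (then `∑ M ≤ m⁶ K_t`, `sum_sum_le_card_sq_mul`). The pair inequality is REFLECTION POSITIVITY
(tree `wilsonExpectation_reflectionPositive_holds` / `…_siteReflectionPositive` /
`…_oddReflectionPositive`, real centred forms of `LangevinControlUVFemtoCurvatureTwoPointMirrorPairs`)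
for the two-plaquette difference `F = P_x − P_y` of one time slice, after transporting `e₂` to the
time axis by the coordinate permutation `(0 1 2)` (tree `wilsonMeasure_map_configPerm`): with `Θ`
the reflection mapping the slice of `x, y` onto the slice at distance `t`,
`0 ≤ Cov(F∘Θ, F) = Cov(P_{θx}, P_x) − Cov(P_{θx}, P_y) − Cov(P_{θy}, P_x) + Cov(P_{θy}, P_y)`, whose
diagonal terms are `K_t` and off-diagonal ones `M_{wv}`, `M_{vw}` by translation invariance (tree
`wilsonMeasure_map_torusConfigShift`); `t ≡ 0 (mod L)` is the case `Θ = id`.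
-/

set_option autoImplicit false

noncomputable section

open MeasureTheory ProbabilityTheory Literature.MathematicalPhysics.QuantumFieldTheory
open Summit.QuantumFields.YangMills.Theorems.FemtoCurvatureTwoPoint.AxisCovNonneg

namespace Summit.QuantumFields.YangMills.Theorems.FemtoCurvatureTwoPointC.SmearingDomination

/-- The plaquette observable `U ↦ Re tr ρ(U_{(a, q)})` as a lambda (local notation). -/
local notation "P⟦" ρ ", " q ", " a "⟧" => (fun U => WilsonRP.plaqRe ρ U (a, q))

/-- Pair inequality `Cov(P_x, P_{y+s}) + Cov(P_y, P_{x+s}) ≤ 2 Cov(P_0, P_s)` (local notation). -/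
local notation "PairLE⟦" ρ ", " β ", " q ", " x ", " y ", " s "⟧" =>
  (cov[P⟦ρ, q, x⟧, P⟦ρ, q, y + s⟧; wilsonMeasure ρ β]
      + cov[P⟦ρ, q, y⟧, P⟦ρ, q, x + s⟧; wilsonMeasure ρ β]
    ≤ 2 * cov[P⟦ρ, q, 0⟧, P⟦ρ, q, s⟧; wilsonMeasure ρ β])

/-- If `M v w + M w v ≤ 2K` for all `v, w`, then `∑_{v,w} M v w ≤ (#ι)² K`. [folklore] -/
theorem sum_sum_le_card_sq_mul {ι : Type*} [Fintype ι] (M : ι → ι → ℝ) (K : ℝ)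
    (h : ∀ v w, M v w + M w v ≤ 2 * K) :
    ∑ v, ∑ w, M v w ≤ (Fintype.card ι : ℝ) ^ 2 * K := by
  have h1 : ∑ v, ∑ w, (M v w + M w v) ≤ ∑ _v : ι, ∑ _w : ι, 2 * K :=
    Finset.sum_le_sum fun v _ => Finset.sum_le_sum fun w _ => h v w
  simp only [Finset.sum_add_distrib, Finset.sum_const, Finset.card_univ, nsmul_eq_mul] at h1
  rw [Finset.sum_comm (f := fun v w => M w v)] at h1
  nlinarith [h1]

section Sites

variable {d L : ℕ} [NeZero d]

/-- Observables of the spatial links of a slice `1 ≤ a ≤ L/2` are positive-time. [folklore] -/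
theorem isPositiveTimeObservable_of_slab {G α : Type*} {F : GaugeConfig d L G → α} {a : ℕ}
    (hF : DependsOn F {e : Edge d L | e.2 ≠ 0 ∧ (e.1 0).val = a}) (h1 : 1 ≤ a)
    (h2 : a ≤ L / 2) : IsPositiveTimeObservable F := by
  refine fun U V hUV => hF fun e he => ?_
  obtain ⟨he2, he0⟩ := he
  have hs : ((e.1.shift e.2) 0).val = a := by rw [WilsonRP.shift_apply_of_ne _ he2.symm]; exact he0
  exact hUV e (he0 ▸ h1) (he0 ▸ h2) (hs ▸ h1) (hs ▸ h2)

/-- `P_{x'} − P_{y'} − c` (plane `q`, slice `t = a`) depends only on the links of the slice. [folklore] -/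
theorem dependsOn_plaqDiff {N : ℕ} {G : Type*} [Group G] (ρ : G →* Matrix (Fin N) (Fin N) ℂ)
    (q : {p : Fin d × Fin d // p.1 < p.2}) (hq : q.1.1 ≠ 0) {x' y' : Site d L} {a : ℕ}
    (hx : (x' 0).val = a) (hy : (y' 0).val = a) (c : ℝ) :
    DependsOn (fun U : GaugeConfig d L G =>
        WilsonRP.plaqRe ρ U (x', q) - WilsonRP.plaqRe ρ U (y', q) - c)
      {e : Edge d L | e.2 ≠ 0 ∧ (e.1 0).val = a} := by
  intro U V hUV
  have h : ∀ z : Site d L, (z 0).val = a →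
      WilsonRP.plaqRe ρ U (z, q) = WilsonRP.plaqRe ρ V (z, q) := fun z hz =>
    dependsOn_plaqRe ρ ((z, q) : Plaquette d L) fun e he => by
      obtain ⟨h2, h0, -⟩ := time_of_mem_edges (p := ((z, q) : Plaquette d L)) hq he
      exact hUV e ⟨h2, h0.trans hz⟩
  simp only [h x' hx, h y' hy]

end Sites

section Wilson

variable {d L N : ℕ} [NeZero L] {G : Type*} [Group G] [TopologicalSpace G]
  [IsTopologicalGroup G] [CompactSpace G] [MeasurableSpace G] [BorelSpace G]
  (ρ : G →* Matrix (Fin N) (Fin N) ℂ)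

/-- Plaquette observables are square integrable (bounded by `N`). [folklore] -/
theorem memLp_plaqRe (hρ : Continuous ρ) (β : ℝ) (p : Plaquette d L) :
    MemLp (fun U : GaugeConfig d L G => WilsonRP.plaqRe ρ U p) 2 (wilsonMeasure ρ β) :=
  haveI := isProbabilityMeasure_wilsonMeasure (d := d) (L := L) ρ hρ β
  MemLp.of_bound (WilsonRP.measurable_plaqRe ρ hρ p).aestronglyMeasurable (N : ℝ)
    (ae_of_all _ fun U => by rw [Real.norm_eq_abs]; exact WilsonRP.abs_plaqRe_le ρ hρ U p)

/-- `E[F F'] − E[F] E[F']` is Mathlib's `cov[F, F']` (square-integrable observables). [folklore] -/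
theorem wexp_cov_eq (hρ : Continuous ρ) (β : ℝ) {F F' : GaugeConfig d L G → ℝ}
    (hF : MemLp F 2 (wilsonMeasure ρ β)) (hF' : MemLp F' 2 (wilsonMeasure ρ β)) :
    wilsonExpectation ρ β (fun U => F U * F' U) - wilsonExpectation ρ β F * wilsonExpectation ρ β F'
      = cov[F, F'; wilsonMeasure ρ β] := by
  haveI := isProbabilityMeasure_wilsonMeasure (d := d) (L := L) ρ hρ β
  rw [covariance_eq_sub hF hF']
  rfl

/-- Translation invariance `Cov(P_{a+v}, P_{b+v}) = Cov(P_a, P_b)` (tree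
`wilsonMeasure_map_torusConfigShift`). [folklore] -/
theorem cov_shift (β : ℝ) (q : {p : Fin d × Fin d // p.1 < p.2}) {a b a' b' : Site d L}
    (v : Site d L) (ha : a' = a + v) (hb : b' = b + v) :
    cov[P⟦ρ, q, a'⟧, P⟦ρ, q, b'⟧; wilsonMeasure ρ β] =
      cov[P⟦ρ, q, a⟧, P⟦ρ, q, b⟧; wilsonMeasure ρ β] := by
  subst ha hb
  have h := covariance_map_equiv (μ := wilsonMeasure (d := d) (L := L) ρ β)
    P⟦ρ, q, a + v⟧ P⟦ρ, q, b + v⟧ (torusConfigShift v)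
  rw [wilsonMeasure_map_torusConfigShift] at h
  simpa only [Function.comp_def, plaqRe_torusConfigShift, add_sub_cancel_right] using h

/-- The pair inequality is even in the separation (translation invariance, symmetry). [folklore] -/
theorem pairLE_of_neg (β : ℝ) (q : {p : Fin d × Fin d // p.1 < p.2}) (x y s : Site d L)
    (h : PairLE⟦ρ, β, q, x, y, -s⟧) : PairLE⟦ρ, β, q, x, y, s⟧ := by
  rw [← cov_shift ρ β q (a := x) (b := y + -s) s rfl rfl,
    ← cov_shift ρ β q (a := y) (b := x + -s) s rfl rfl, ← cov_shift ρ β q (a := 0) (b := -s) s rfl rfl,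
    neg_add_cancel_right, neg_add_cancel_right, zero_add, neg_add_cancel,
    covariance_comm P⟦ρ, q, x + s⟧ P⟦ρ, q, y⟧, covariance_comm P⟦ρ, q, y + s⟧ P⟦ρ, q, x⟧,
    covariance_comm P⟦ρ, q, s⟧ P⟦ρ, q, (0 : Site d L)⟧] at h
  linarith

variable [NeZero d]

/-- **Pair inequality from centred reflection positivity.** `Θ` preserves the Wilson state,
acts on the spatial `q`-plaquettes through `θ`, a translation by `s` on the slice `t = a < L`, and
`∫ F(ΘU) F(U) ≥ 0` for bounded measurable observables of the spatial links of that slice; then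
`Cov(P_x, P_{y+s}) + Cov(P_y, P_{x+s}) ≤ 2 Cov(P_0, P_s)` for `x, y` in the slice `t = 0`
(positivity for the CENTRED difference `P_{x+ae₀} − P_{y+ae₀}`, expanded, translated). [folklore] -/
theorem pair_le_of_centredRP (hρ : Continuous ρ) (β : ℝ) (q : {p : Fin d × Fin d // p.1 < p.2})
    (hq : q.1.1 ≠ 0) {Θ : GaugeConfig d L G → GaugeConfig d L G} (hΘm : Measurable Θ)
    (hΘμ : (wilsonMeasure ρ β).map Θ = wilsonMeasure ρ β) (θ : Site d L → Site d L)
    (hrefl : ∀ (U : GaugeConfig d L G) (z : Site d L),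
      WilsonRP.plaqRe ρ (Θ U) (z, q) = WilsonRP.plaqRe ρ U (θ z, q))
    (x y : Site d L) (hx0 : x 0 = 0) (hy0 : y 0 = 0) {a : ℕ} (haL : a < L) (s : Site d L)
    (hθ : ∀ z : Site d L, z 0 = ((a : ℕ) : ZMod L) → θ z = z + s)
    (hRP : ∀ F : GaugeConfig d L G → ℝ, Measurable F → (∃ C : ℝ, ∀ U, |F U| ≤ C) →
      DependsOn F {e : Edge d L | e.2 ≠ 0 ∧ (e.1 0).val = a} →
        0 ≤ ∫ U, F (Θ U) * F U ∂(wilsonMeasure ρ β)) :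
    PairLE⟦ρ, β, q, x, y, s⟧ := by
  haveI := isProbabilityMeasure_wilsonMeasure (d := d) (L := L) ρ hρ β
  set w : Site d L := Pi.single (0 : Fin d) ((a : ℕ) : ZMod L) with hw
  have h0w : ∀ z : Site d L, z 0 = 0 → (z + w) 0 = ((a : ℕ) : ZMod L) := fun z hz => by
    simp [hw, hz]
  have hval : ∀ z : Site d L, z 0 = 0 → ((z + w) 0).val = a := fun z hz => by
    rw [h0w z hz, ZMod.val_natCast, Nat.mod_eq_of_lt haL]
  have hm : ∀ z : Site d L, MemLp P⟦ρ, q, z⟧ 2 (wilsonMeasure ρ β) := fun z =>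
    memLp_plaqRe ρ hρ β (z, q)
  have hF : Measurable fun U : GaugeConfig d L G =>
      WilsonRP.plaqRe ρ U (x + w, q) - WilsonRP.plaqRe ρ U (y + w, q) :=
    (WilsonRP.measurable_plaqRe ρ hρ _).sub (WilsonRP.measurable_plaqRe ρ hρ _)
  -- reflection positivity of the centred difference
  have hc : ∀ c : ℝ, 0 ≤ ∫ U,
      (WilsonRP.plaqRe ρ (Θ U) (x + w, q) - WilsonRP.plaqRe ρ (Θ U) (y + w, q) - c)
        * (WilsonRP.plaqRe ρ U (x + w, q) - WilsonRP.plaqRe ρ U (y + w, q) - c)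
          ∂(wilsonMeasure ρ β) := fun c =>
    hRP (fun U => WilsonRP.plaqRe ρ U (x + w, q) - WilsonRP.plaqRe ρ U (y + w, q) - c)
      (hF.sub_const c)
      ⟨N + N + |c|, fun U => (abs_sub _ _).trans (add_le_add ((abs_sub _ _).trans
        (add_le_add (WilsonRP.abs_plaqRe_le ρ hρ U _) (WilsonRP.abs_plaqRe_le ρ hρ U _))) le_rfl)⟩
      (dependsOn_plaqDiff ρ q hq (hval x hx0) (hval y hy0) c)
  have h0 := (hc _).trans_eq
    (FiniteSusceptibilityWeakCoupling.RPCauchySchwarz.covariance_comp_eq hΘm hΘμ hF _).symm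
  -- `F ∘ Θ = P_{x+w+s} − P_{y+w+s}`; expand and translate
  simp only [hrefl, hθ _ (h0w x hx0), hθ _ (h0w y hy0)] at h0
  rw [covariance_fun_sub_fun_sub (hm _) (hm _) (hm _) (hm _),
    cov_shift ρ β q (a := s) (b := 0) (a' := x + w + s) (b' := x + w) (x + w) (by abel) (by abel),
    cov_shift ρ β q (a := x + s) (b := y) (a' := x + w + s) (b' := y + w) w (by abel) rfl,
    cov_shift ρ β q (a := y + s) (b := x) (a' := y + w + s) (b' := x + w) w (by abel) rfl,
    cov_shift ρ β q (a := s) (b := 0) (a' := y + w + s) (b' := y + w) (y + w) (by abel) (by abel),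
    covariance_comm P⟦ρ, q, x + s⟧ P⟦ρ, q, y⟧,
    covariance_comm P⟦ρ, q, y + s⟧ P⟦ρ, q, x⟧, covariance_comm P⟦ρ, q, s⟧ P⟦ρ, q, 0⟧] at h0
  linarith

/-- Link reflection `θ(t, x⃗) = (1 − t, x⃗)` (`L` even, or `L` odd `≥ 3`; `β ≥ 0`): for `x, y` in
the slice `t = 0` and `1 ≤ a ≤ L/2`, the pair inequality at separation `(1 − 2a) e₀`. [folklore] -/
theorem pairLE_timeReflect (hρ : Continuous ρ) {β : ℝ} (hβ : 0 ≤ β) (hL2 : 2 ≤ L)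
    (q : {p : Fin d × Fin d // p.1 < p.2}) (hq : q.1.1 ≠ 0) (x y : Site d L) (hx0 : x 0 = 0)
    (hy0 : y 0 = 0) {a : ℕ} (h1 : 1 ≤ a) (h2 : a ≤ L / 2) :
    PairLE⟦ρ, β, q, x, y, Pi.single (0 : Fin d) (1 - 2 * ((a : ℕ) : ZMod L))⟧ := by
  refine pair_le_of_centredRP ρ hρ β q hq WilsonRP.measurable_timeReflect
    (FiniteSusceptibilityWeakCoupling.RPCauchySchwarz.wilsonMeasure_map_timeReflect ρ hρ β)
    Site.timeReflect
    (fun U z => by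
      rw [WilsonRP.plaqRe_timeReflect ρ hρ U (z, q), plaqReflect_of_ne (p := (z, q)) hq])
    x y hx0 hy0 (a := a) (by omega) _
    (fun z hz => by
      funext k
      rcases eq_or_ne k 0 with rfl | hk
      · simp [Site.timeReflect, hz]; ring
      · simp [Site.timeReflect, hk])
    fun F hF hFb hdep => ?_
  rcases Nat.even_or_odd L with hL | hL
  · exact integral_timeReflect_mul_nonneg_even ρ hL hρ hβ F hF hFb
      (isPositiveTimeObservable_of_slab hdep h1 h2)
  · -- the links of the slice `t = a` are odd-positive
    exact integral_timeReflect_mul_nonneg_odd ρ hL (by obtain ⟨r, hr⟩ := hL; omega) hρ hβ F hF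
      hFb (hdep.mono (by rintro e ⟨-, he0⟩; simp [WilsonOddRP.IsOPosEdge, he0, h1, h2]))

/-- **The pair inequality on the time axis** `Cov(P_x, P_{y+ne₀}) + Cov(P_y, P_{x+ne₀}) ≤
2 Cov(P_0, P_{ne₀})` (`β ≥ 0`, spatial plane `q`, `x, y` in the slice `t = 0`). Cases as in
`AxisCovNonneg.timeAxisCov_nonneg`: `n ≡ 0` (`Θ = id`); odd `n`: link mirror through the slice
`(n+1)/2`; even `n`: site mirror `θ'(t, x⃗) = (−t, x⃗)` through `n/2` (`L` even) or link mirror at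
separation `n − L` (`L` odd). [folklore] -/
theorem pairLE_timeAxis (hρ : Continuous ρ) {β : ℝ} (hβ : 0 ≤ β)
    (q : {p : Fin d × Fin d // p.1 < p.2}) (hq : q.1.1 ≠ 0) (x y : Site d L) (hx0 : x 0 = 0)
    (hy0 : y 0 = 0) (n : ℕ) :
    PairLE⟦ρ, β, q, x, y, Pi.single (0 : Fin d) ((n : ℕ) : ZMod L)⟧ := by
  have hL0 : 0 < L := Nat.pos_of_ne_zero (NeZero.ne L)
  rw [← ZMod.natCast_mod n L]
  have hn'L : n % L < L := Nat.mod_lt n hL0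
  generalize n % L = n' at hn'L ⊢
  -- from the inequality at a separation `c e₀` with `c = ± n'`
  have key : ∀ c : ZMod L, (c = ((n' : ℕ) : ZMod L) ∨ c = -((n' : ℕ) : ZMod L)) →
      PairLE⟦ρ, β, q, x, y, Pi.single (0 : Fin d) c⟧ →
      PairLE⟦ρ, β, q, x, y, Pi.single (0 : Fin d) ((n' : ℕ) : ZMod L)⟧ := by
    rintro c (rfl | rfl) h
    · exact h
    · rw [Pi.single_neg] at h
      exact pairLE_of_neg ρ β q x y _ h
  rcases Nat.eq_zero_or_pos n' with rfl | hn1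
  · -- `n ≡ 0`: `Θ = id`, the variance of `P_x − P_y` is non-negative
    refine key 0 (Or.inl (by simp)) ?_
    have h := pair_le_of_centredRP ρ hρ β q hq (Θ := id) measurable_id Measure.map_id id
      (fun U z => rfl) x y hx0 hy0 hL0 0 (fun z _ => (add_zero z).symm)
      (fun F _ _ _ => integral_nonneg fun U => mul_self_nonneg _)
    simpa only [Pi.single_zero] using h
  have hL2 : 2 ≤ L := by omega
  rcases Nat.even_or_odd n' with hn | hn
  · obtain ⟨t, rfl⟩ := hn
    rcases Nat.even_or_odd L with hL | hL
    · -- even torus, even separation `2t`: site mirror through the slice `t`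
      haveI : Fact (1 < L) := ⟨by omega⟩
      obtain ⟨r, hr⟩ := id hL
      refine key _ (Or.inr (by push_cast; ring))
        (pair_le_of_centredRP ρ hρ β q hq WilsonSiteRP.measurable_negReflect
          (WilsonSiteRP.wilsonMeasure_map_negReflect ρ hL hρ β) Site.negReflect
          (fun U z => by
            rw [WilsonSiteRP.plaqRe_negReflect ρ hρ U (z, q),
              sitePlaqReflect_of_ne (p := (z, q)) hq])
          x y hx0 hy0 (a := t) (by omega) (Pi.single (0 : Fin d) (-(2 * ((t : ℕ) : ZMod L))))
          (fun z hz => by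
            funext k
            rcases eq_or_ne k 0 with rfl | hk
            · simp [Site.negReflect, hz]; ring
            · simp [Site.negReflect, hk])
          fun F hF hFb hdep => integral_negReflect_mul_nonneg ρ hL hρ β F hF hFb
            (hdep.mono (by  -- the spatial links of the slice `t`, `1 ≤ t < L/2`, are site-positive
              rintro e ⟨he2, he0⟩
              simp [WilsonSiteRP.IsSitePosEdge, he2, he0, show 1 ≤ t by omega,
                show t < L / 2 by omega])))
    · -- odd torus `2r+1`, even separation `2t`: link mirror through the slice `r-t+1`
      obtain ⟨r, hr⟩ := hL
      refine key _ (Or.inl ?_)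
        (pairLE_timeReflect ρ hρ hβ hL2 q hq x y hx0 hy0 (a := r - t + 1) (by omega) (by omega))
      have hL' : ((2 * r + 1 : ℕ) : ZMod L) = 0 := by rw [← hr]; exact ZMod.natCast_self L
      have hrt : t ≤ r := by omega
      push_cast [Nat.cast_sub hrt] at hL' ⊢
      linear_combination (-1 : ZMod L) * hL'
  · -- odd separation `2k+1`: link mirror through the slice `k+1`
    obtain ⟨k, rfl⟩ := hn
    exact key _ (Or.inr (by push_cast; ring))
      (pairLE_timeReflect ρ hρ hβ hL2 q hq x y hx0 hy0 (a := k + 1) (by omega) (by omega))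

end Wilson

section Crux

/-- The crux's plaquette field `P_x(U) = N − Re tr ρ(U_{p(x;0,1)})` (local notation). -/
local notation "P01⟦" N ", " ρ ", " x "⟧" => (fun U => ((N : ℕ) : ℝ)
  - Complex.re (Matrix.trace (ρ (plaquetteHolonomy U x (0 : Fin 4) (1 : Fin 4)))))

/-- The coordinate permutation `σ = (0 1 2)` (`σ 0 = 1`, `σ 1 = 2`, `σ 2 = 0`; local notation). -/
local notation "σ012" => (Equiv.swap (0 : Fin 4) 1 * Equiv.swap (1 : Fin 4) 2)

/-- The coordinate plane `(0, 1)` (local notation). -/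
local notation "plane01" =>
  (Subtype.mk ((0 : Fin 4), (1 : Fin 4)) (by decide) : {p : Fin 4 × Fin 4 // Prod.fst p < Prod.snd p})

/-- The coordinate plane `(1, 2)` (local notation). -/
local notation "plane12" =>
  (Subtype.mk ((1 : Fin 4), (2 : Fin 4)) (by decide) : {p : Fin 4 × Fin 4 // Prod.fst p < Prod.snd p})

variable {L N : ℕ} [NeZero L] {G : Type*} [Group G] [TopologicalSpace G] [IsTopologicalGroup G]
  [CompactSpace G] [MeasurableSpace G] [BorelSpace G] (ρ : G →* Matrix (Fin N) (Fin N) ℂ)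

/-- **Transport to the time axis** `Cov(P_x, P_y) = Cov(Re tr ρ U_{(σx;1,2)}, Re tr ρ U_{(σy;1,2)})`
(`Cov(N − A, N − B) = Cov(A, B)`; `σ = (0 1 2)`, tree `wilsonMeasure_map_configPerm`). [folklore] -/
theorem cov_cruxP_eq (hρ : Continuous ρ) (β : ℝ) (x y : Site 4 L) :
    cov[P01⟦N, ρ, x⟧, P01⟦N, ρ, y⟧; wilsonMeasure ρ β] =
      cov[P⟦ρ, plane12, sitePerm σ012 x⟧, P⟦ρ, plane12, sitePerm σ012 y⟧; wilsonMeasure ρ β] := by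
  haveI := isProbabilityMeasure_wilsonMeasure (d := 4) (L := L) ρ hρ β
  have hA : ∀ z : Site 4 L, P01⟦N, ρ, z⟧ =
      fun U : GaugeConfig 4 L G => (N : ℝ) - WilsonRP.plaqRe ρ U (z, plane01) := fun z => rfl
  rw [hA, hA,
    covariance_const_sub_left ((memLp_plaqRe ρ hρ β (x, plane01)).integrable one_le_two),
    covariance_const_sub_right ((memLp_plaqRe ρ hρ β (y, plane01)).integrable one_le_two),
    neg_neg]
  have hperm : ∀ (z : Site 4 L) (U : GaugeConfig 4 L G),
      WilsonRP.plaqRe ρ (configPerm (Equiv.symm σ012) U) (z, plane01) =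
        WilsonRP.plaqRe ρ U (sitePerm σ012 z, plane12) := fun z U => by
    simp only [WilsonRP.plaqRe, plaquetteHolonomy_configPerm, Equiv.symm_symm,
      show σ012 0 = 1 by decide, show σ012 1 = 2 by decide]
  have e := covariance_map_equiv (μ := wilsonMeasure (d := 4) (L := L) ρ β)
    P⟦ρ, plane01, x⟧ P⟦ρ, plane01, y⟧ (configPerm (Equiv.symm σ012))
  rw [wilsonMeasure_map_configPerm ρ hρ β] at e
  simpa only [Function.comp_def, hperm] using e

/-- **Smearing domination** `Cov(c ∑ P_{X v}, c ∑ P_{Y v}) ≤ Cov(P_0, P_{t e₂})` for base points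
`X v` in the slice `x₂ = 0`, `Y v = X v + t e₂`, `c ≥ 0`, `c · #ι = 1` (bilinearity, the pair
inequality `pairLE_timeAxis` transported by `cov_cruxP_eq`, `sum_sum_le_card_sq_mul`). [folklore] -/
theorem cov_blockAverage_le (hρ : Continuous ρ) {β : ℝ} (hβ : 0 ≤ β) {ι : Type*}
    [Fintype ι] {c : ℝ} (hc0 : 0 ≤ c) (hc : c * (Fintype.card ι : ℝ) = 1) (t : ℕ)
    (X Y : ι → Site 4 L)
    (hX : ∀ v, X v 2 = 0) (hY : ∀ v, Y v = X v + Pi.single (2 : Fin 4) ((t : ℕ) : ZMod L)) :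
    wilsonExpectation ρ β (fun U : GaugeConfig 4 L G =>
          (c * ∑ v, P01⟦N, ρ, X v⟧ U) * (c * ∑ v, P01⟦N, ρ, Y v⟧ U))
        - wilsonExpectation ρ β (fun U : GaugeConfig 4 L G => c * ∑ v, P01⟦N, ρ, X v⟧ U)
          * wilsonExpectation ρ β (fun U : GaugeConfig 4 L G => c * ∑ v, P01⟦N, ρ, Y v⟧ U) ≤
      wilsonExpectation ρ β (fun U : GaugeConfig 4 L G =>
          P01⟦N, ρ, (0 : Site 4 L)⟧ U * P01⟦N, ρ, (Pi.single 2 ((t : ℕ) : ZMod L) : Site 4 L)⟧ U)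
        - wilsonExpectation ρ β P01⟦N, ρ, (0 : Site 4 L)⟧
          * wilsonExpectation ρ β P01⟦N, ρ, (Pi.single 2 ((t : ℕ) : ZMod L) : Site 4 L)⟧ := by
  haveI := isProbabilityMeasure_wilsonMeasure (d := 4) (L := L) ρ hρ β
  have hmem : ∀ x : Site 4 L, MemLp P01⟦N, ρ, x⟧ 2 (wilsonMeasure ρ β) := fun x =>
    (memLp_const (N : ℝ)).sub (memLp_plaqRe ρ hρ β (((x, plane01) : Plaquette 4 L)))
  have hmemS : ∀ Z : ι → Site 4 L,
      MemLp (fun U : GaugeConfig 4 L G => c * ∑ v, P01⟦N, ρ, Z v⟧ U) 2 (wilsonMeasure ρ β) :=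
    fun Z => (memLp_finsetSum _ fun v _ => hmem (Z v)).const_mul c
  rw [wexp_cov_eq ρ hρ β (hmemS X) (hmemS Y), wexp_cov_eq ρ hρ β (hmem 0) (hmem _),
    covariance_const_mul_left, covariance_const_mul_right,
    covariance_fun_sum_fun_sum (fun v => hmem (X v)) (fun w => hmem (Y w))]
  -- the pair inequality, transported to the time axis of the `(1,2)` plane
  have hs0 : sitePerm σ012 (0 : Site 4 L) = 0 :=
    funext fun j => by simp only [sitePerm_apply, Pi.zero_apply]
  have hX' : ∀ v, sitePerm σ012 (X v) 0 = 0 := fun v => by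
    rw [sitePerm_apply, show (Equiv.symm σ012) 0 = 2 by decide]; exact hX v
  have hpair : ∀ v w : ι,
      cov[P01⟦N, ρ, X v⟧, P01⟦N, ρ, Y w⟧; wilsonMeasure ρ β]
          + cov[P01⟦N, ρ, X w⟧, P01⟦N, ρ, Y v⟧; wilsonMeasure ρ β] ≤
        2 * cov[P01⟦N, ρ, (0 : Site 4 L)⟧, P01⟦N, ρ, (Pi.single 2 ((t : ℕ) : ZMod L) : Site 4 L)⟧;
          wilsonMeasure ρ β] :=
    fun v w => by
      rw [hY w, hY v, cov_cruxP_eq ρ hρ, cov_cruxP_eq ρ hρ, cov_cruxP_eq ρ hρ]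
      simp only [sitePerm_add, sitePerm_single, show σ012 2 = 0 by decide, hs0]
      exact pairLE_timeAxis ρ hρ hβ plane12 (by decide) _ _ (hX' v) (hX' w) t
  have hsum := sum_sum_le_card_sq_mul
    (fun v w => cov[P01⟦N, ρ, X v⟧, P01⟦N, ρ, Y w⟧; wilsonMeasure ρ β]) _ hpair
  refine (mul_le_mul_of_nonneg_left (mul_le_mul_of_nonneg_left hsum hc0) hc0).trans_eq ?_
  rw [show ∀ K : ℝ, c * (c * ((Fintype.card ι : ℝ) ^ 2 * K)) = (c * Fintype.card ι) ^ 2 * K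
    from fun K => by ring, hc, one_pow, one_mul]

end Crux

end SmearingDomination

/-- **Registered sub-goal `smearingDomination`** (line `birth`, wave 2; verbatim the stub
`stub_smearingDomination` of the line `conditional-covariance-floor`): block smearing of the
`01`-plaquette field over cubes of side `m` inside the slices `x₂ = 0`, `x₂ = t` only LOWERS the
covariance across `e₂`: `Cov(B_m(0), B_m(t)) ≤ Cov(P_0^{01}, P_{t e₂}^{01})` for every compact `G`,
continuous `ρ`, `β ≥ 0`, `L`, `1 ≤ m ≤ L` (`SmearingDomination.cov_blockAverage_le`). [folklore] -/
theorem smearingDomination :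
    ∀ (L N : ℕ) [NeZero L] (G : Type) [Group G] [TopologicalSpace G] [IsTopologicalGroup G]
        [CompactSpace G] [MeasurableSpace G] [BorelSpace G] (ρ : G →* Matrix (Fin N) (Fin N) ℂ),
        Continuous ρ → ∀ (β : ℝ), 0 ≤ β → ∀ (m t : ℕ), 1 ≤ m → m ≤ L →
        ∀ (P : (Fin 4 → ZMod L) → Fin 4 → Fin 4 → GaugeConfig 4 L G → ℝ)
          (B : ℕ → GaugeConfig 4 L G → ℝ) (E : (GaugeConfig 4 L G → ℝ) → ℝ),
          (P = fun x i j U => (N : ℝ) - (ρ (plaquetteHolonomy U x i j)).trace.re) →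
          (B = fun s U => (((m : ℕ) : ℝ) ^ 3)⁻¹ *
              ∑ v : Fin (m) × Fin (m) × Fin (m),
                P ![((v.1 : ℕ) : ZMod L), ((v.2.1 : ℕ) : ZMod L), ((s : ℕ) : ZMod L), ((v.2.2 : ℕ) : ZMod L)] 0 1 U) →
          (E = fun F => wilsonExpectation ρ β F) →
          E (fun U => B 0 U * B t U) - E (B 0) * E (B t) ≤
            E (fun U => P 0 0 1 U * P (Pi.single (2 : Fin 4) ((t : ℕ) : ZMod L)) 0 1 U)
              - E (P 0 0 1) * E (P (Pi.single (2 : Fin 4) ((t : ℕ) : ZMod L)) 0 1) := by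
  intro L N _ G _ _ _ _ _ _ ρ hρ β hβ m t hm _ P B E hP hB hE
  subst hP hB hE
  have hc : (((m : ℕ) : ℝ) ^ 3)⁻¹ * (Fintype.card (Fin m × Fin m × Fin m) : ℝ) = 1 := by
    rw [Fintype.card_prod, Fintype.card_prod, Fintype.card_fin]
    push_cast
    rw [← pow_three, inv_mul_cancel₀ (pow_ne_zero 3 (Nat.cast_ne_zero.2 (by omega)))]
  have hX : ∀ v : Fin m × Fin m × Fin m, (![((v.1 : ℕ) : ZMod L), ((v.2.1 : ℕ) : ZMod L),
      ((0 : ℕ) : ZMod L), ((v.2.2 : ℕ) : ZMod L)] : Site 4 L) 2 = 0 := fun v => by simp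
  have hY : ∀ v : Fin m × Fin m × Fin m, (![((v.1 : ℕ) : ZMod L), ((v.2.1 : ℕ) : ZMod L),
      ((t : ℕ) : ZMod L), ((v.2.2 : ℕ) : ZMod L)] : Site 4 L) = ![((v.1 : ℕ) : ZMod L),
        ((v.2.1 : ℕ) : ZMod L), ((0 : ℕ) : ZMod L), ((v.2.2 : ℕ) : ZMod L)]
          + Pi.single (2 : Fin 4) ((t : ℕ) : ZMod L) := fun v => by
    funext j
    fin_cases j <;> simp
  exact SmearingDomination.cov_blockAverage_le ρ hρ hβ (by positivity) hc t _ _ hX hY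

end Summit.QuantumFields.YangMills.Theorems.FemtoCurvatureTwoPointC

end
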